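import Summits.CriticalPhenomena.Ising3DConformalLimit.Theorems.ArmDressingArmDressingGlueInvSystems
import Summits.CriticalPhenomena.Ising3DConformalLimit.Theorems.ArmDressingArmDressingGlueDressedLimitExists
import Summits.CriticalPhenomena.Ising3DConformalLimit.Theorems.ArmDressingArmDressingGlueWiredBoxLimit
import Summits.CriticalPhenomena.Ising3DConformalLimit.Theorems.ArmDressingArmDressingGlueArm1Pos
import Summits.CriticalPhenomena.Ising3DConformalLimit.Theorems.ArmDressingArmDressingGlueEdwardsSokal
import Summits.CriticalPhenomena.Ising3DConformalLimit.Theorems.MoebiusLimitExists.Negative.ScaleRedundant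
import HarnessLib

/-!
# Route `ArmDressing`, crux `ArmDressingGlue` (stmt-CriticalPhenomena-15700):
# stub `stub_armDoubling`

Scale regularity of the one-arm probability IN ONE-ARM UNITS (skeleton v3 of the line `registered`
of the crux `ArmDressingGlue`).  Write `a(K) := arm1 K⁻¹ 1` for the critical FK-Ising probability
that the origin is connected to `{x ∈ ℤ³ : ‖x‖ ≥ K}` (Euclidean norm, read through the mesh
embedding `mesh K⁻¹`).  From cruxes B (`EvenPatternDecoupling`) and C (`ArmExtensionFactorisation`):

* (i) dyadic doubling: there are `λ > 0` with `λ² < 8` and `K₀ > 0` such that `a(K/2) ≤ λ a(K)` for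
  all `K ≥ K₀` (here `λ = 5/2`);
* (ii) `a` is antitone on `(0, ∞)`;
* (iii) `0 < a(K) ≤ 1` for `K ≥ 1`.

Proof.  The support ES holds (its landed clauses `stub_wiredBoxLimit`, `stub_arm1Pos`,
`stub_edwardsSokalIdentity`, repacked by `infiniteVolumeEdwardsSokal_iff`), so the dressed limit `S`
exists (`DressedLimitProof.stub_dressedLimitExists`, Camia–Feng Thm 1 transposed); its normalisation
off the coincident locus has the same limit and two-point function and is scale covariant with SOME
dimension `Δ ∈ [1/2, 1]` (`MoebiusLimitExistsNegative.exists_scaleCovariant_normalised`).  The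
one-arm ratio lemma (`InvBook.tendsto_arm1_ratio`, Camia–Feng Lemma 17) with `κ = 1/2` gives
`a(K/2)/a(K) = arm1((K⁻¹)/(1/2), 1)/arm1(K⁻¹, 1) → (1/2)^{-Δ} = 2^Δ ≤ 2 < 5/2` as `K → ∞`
(`δ = K⁻¹ → 0⁺`), whence (i) since `a(K) > 0`.  (ii) is monotonicity of the connection law in the
probe sets (`InvBook.Pr_mono_set`): the far set `{x : ‖K'⁻¹ x‖ ≥ 1}` is contained in
`{x : ‖K⁻¹ x‖ ≥ 1}` for `0 < K ≤ K'`.  (iii) is `Arm1Pos` at `δ = K⁻¹ ∈ (0, 1]` and `Pr ≤ 1`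
(`InvBook.Pr_mem_Icc`).

References: F. Camia, Y. Feng, arXiv:2411.01467 (SPA 2025), Thm 1 and Lemma 17;
G. Grimmett, *The Random-Cluster Model* (2006), Thm 4.19.
-/

noncomputable section

namespace Summit.CriticalPhenomena.Ising3DConformalLimit.Cruxes.ArmDressingGlue.CrossPos

open Summit.CriticalPhenomena.Ising3DConformalLimit.Cruxes.ArmDressingGlue.Vocab
open Summit.CriticalPhenomena.Ising3DConformalLimit.Theses
open Literature.Probability.LatticeModels Literature.Probability.Percolation
open Literature.Barriers.CriticalPhenomena Filter Set
open scoped Topology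

/-- The one-arm probe family `![{0}, {x : ‖δ x‖ ≥ 1}]` is finite-or-co-finite memberwise (`δ > 0`).
[folklore] -/
theorem arm1_probes_finite_or_cofinite {δ : ℝ} (hδ : 0 < δ) :
    ∀ i : Fin 2,
      ((![{(0 : Site 3)}, disc δ (Metric.ball (0 : EuclideanSpace ℝ (Fin 3)) 1)ᶜ] :
          Fin 2 → Set (Site 3)) i).Finite ∨
        (((![{(0 : Site 3)}, disc δ (Metric.ball (0 : EuclideanSpace ℝ (Fin 3)) 1)ᶜ] :
          Fin 2 → Set (Site 3)) i)ᶜ).Finite := by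
  intro i
  fin_cases i
  · exact Or.inl (Set.finite_singleton _)
  · exact Or.inr (InvBook.cofinite_disc_compl hδ Metric.isBounded_ball)

/-- The far set shrinks as the scale grows: `{x : ‖K'⁻¹ x‖ ≥ 1} ⊆ {x : ‖K⁻¹ x‖ ≥ 1}` for
`0 < K ≤ K'`. [folklore] -/
theorem disc_ball_compl_anti {K K' : ℝ} (hK : 0 < K) (hKK' : K ≤ K') :
    disc K'⁻¹ (Metric.ball (0 : EuclideanSpace ℝ (Fin 3)) 1)ᶜ ⊆
      disc K⁻¹ (Metric.ball (0 : EuclideanSpace ℝ (Fin 3)) 1)ᶜ := by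
  intro x hx
  simp only [mem_disc, mem_compl_iff, Metric.mem_ball, dist_zero_right, not_lt] at hx ⊢
  rw [mesh_eq_smul, norm_smul, Real.norm_eq_abs] at hx ⊢
  rw [abs_of_pos (inv_pos.2 (hK.trans_le hKK'))] at hx
  rw [abs_of_pos (inv_pos.2 hK)]
  exact hx.trans (mul_le_mul_of_nonneg_right (inv_anti₀ hK hKK') (norm_nonneg _))

/-- **(ii) The one-arm probability `a(K) = arm1 K⁻¹ 1` is antitone in the scale `K > 0`**
(monotonicity of the connection law in the probe sets). [folklore] -/
theorem arm1_inv_antitone : ∀ K K' : ℝ, 0 < K → K ≤ K' → arm1 K'⁻¹ 1 ≤ arm1 K⁻¹ 1 := by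
  intro K K' hK hKK'
  have hK' : 0 < K' := hK.trans_le hKK'
  show Pr 2 _ _ ≤ Pr 2 _ _
  refine InvBook.Pr_mono_set (arm1_probes_finite_or_cofinite (inv_pos.2 hK'))
    (arm1_probes_finite_or_cofinite (inv_pos.2 hK)) (fun i => ?_) (fun ρ ρ' hρ h => h 0 1 hρ)
  fin_cases i
  · exact subset_rfl
  · exact disc_ball_compl_anti hK hKK'

/-- **(iii) `0 < a(K) ≤ 1` for `K ≥ 1`** (`Arm1Pos` at `δ = K⁻¹ ∈ (0,1]`, and `Pr ≤ 1`). [folklore] -/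
theorem arm1_inv_pos_le_one (hpos : Arm1Pos) :
    ∀ K : ℝ, 1 ≤ K → 0 < arm1 K⁻¹ 1 ∧ arm1 K⁻¹ 1 ≤ 1 := by
  intro K hK
  have hK0 : 0 < K := one_pos.trans_le hK
  exact ⟨hpos _ ⟨inv_pos.2 hK0, inv_le_one_of_one_le₀ hK⟩,
    (InvBook.Pr_mem_Icc (arm1_probes_finite_or_cofinite (inv_pos.2 hK0)) _).2⟩

/-- `2^Δ ≤ 2 < 5/2` for `Δ ≤ 1`, written as `(1/2)^{-Δ} < 5/2`. [folklore] -/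
theorem half_rpow_neg_lt {Δ : ℝ} (hΔ : Δ ≤ 1) : ((1:ℝ) / 2) ^ (-Δ) < 5 / 2 := by
  have hval : ((1:ℝ) / 2) ^ (-Δ) ≤ 2 := by
    rw [one_div, Real.inv_rpow zero_le_two, ← Real.rpow_neg zero_le_two, neg_neg]
    calc (2:ℝ) ^ Δ ≤ 2 ^ (1:ℝ) := Real.rpow_le_rpow_of_exponent_le one_le_two hΔ
      _ = 2 := Real.rpow_one 2
  linarith

/-- **(i) Dyadic doubling of the one-arm probability** from the one-arm ratio of a scale-covariant
`ρ₁`-limit with dimension `Δ ≤ 1`: `a(K/2) ≤ (5/2) a(K)` for `K` large (Camia–Feng Lemma 17: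
`a(K/2)/a(K) → 2^Δ ≤ 2`). [cite: CamiaFeng2025, Lemma 17] -/
theorem arm1_inv_doubling {S : CorrFamily 3} {Δ : ℝ} (hpos : Arm1Pos)
    (hlim : HasPointwiseScalingLimit (criticalCorr 3) rho1 S) (hnd : IsNondegenerateTwoPoint S)
    (hsc : IsScaleCovariant Δ S) (hΔ : Δ ≤ 1) :
    ∃ lam K₀ : ℝ, 0 < lam ∧ lam ^ 2 < 8 ∧ 0 < K₀ ∧
      ∀ K : ℝ, K₀ ≤ K → arm1 (K / 2)⁻¹ 1 ≤ lam * arm1 K⁻¹ 1 := by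
  -- the one-arm ratio at `κ = 1/2`, eventually below `5/2` along `δ → 0⁺`
  have ht := InvBook.tendsto_arm1_ratio hpos hlim hnd hsc (κ := 1 / 2) one_half_pos
  have hev : ∀ᶠ δ in 𝓝[>] (0:ℝ), arm1 (δ / (1 / 2)) 1 / arm1 δ 1 < 5 / 2 :=
    ht.eventually_lt_const (half_rpow_neg_lt hΔ)
  -- transport to `K → ∞` through `δ = K⁻¹`
  obtain ⟨K₀, hK₀⟩ := eventually_atTop.1
    ((tendsto_inv_atTop_nhdsGT_zero.eventually hev).and (eventually_ge_atTop (1:ℝ)))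
  have hK₀1 : 1 ≤ K₀ := (hK₀ K₀ le_rfl).2
  refine ⟨5 / 2, K₀, by norm_num, by norm_num, one_pos.trans_le hK₀1, fun K hK => ?_⟩
  obtain ⟨h1, hK1⟩ := hK₀ K hK
  have ha : 0 < arm1 K⁻¹ 1 :=
    hpos _ ⟨inv_pos.2 (one_pos.trans_le hK1), inv_le_one_of_one_le₀ hK1⟩
  have heq : (K / 2)⁻¹ = K⁻¹ / (1 / 2) := by
    rw [inv_div, div_div_eq_mul_div, div_eq_mul_inv, mul_comm]
    simp
  rw [heq]
  exact ((div_lt_iff₀ ha).1 h1).le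

/-- **STUB `stub_armDoubling` — dyadic doubling, antitonicity and range of the one-arm probability**
(from B, C: the dressed limit, normalised, is scale covariant with `Δ ∈ [1/2, 1]` by
`MoebiusLimitExistsNegative.exists_scaleCovariant_normalised`; then `InvBook.tendsto_arm1_ratio` with
`κ = 1/2` along `δ = K⁻¹`: `a(K/2)/a(K) → 2^Δ ≤ 2 < 5/2 =: λ`, `λ² = 25/4 < 8`; antitone by
`InvBook.Pr_mono_set` (the far set `disc K⁻¹ (ball 0 1)ᶜ = {‖x‖ ≥ K}` shrinks as `K` grows);
`0 < a(K)` for `K ≥ 1` is `Arm1Pos`, `a ≤ 1` is `InvBook.Pr_mem_Icc`). [cite: CamiaFeng2025, Lemma 17] -/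
theorem stub_armDoubling :
    ArmDressing.EvenPatternDecoupling → ArmDressing.ArmExtensionFactorisation →
      (∃ lam K₀ : ℝ, 0 < lam ∧ lam ^ 2 < 8 ∧ 0 < K₀ ∧
          ∀ K : ℝ, K₀ ≤ K → arm1 (K / 2)⁻¹ 1 ≤ lam * arm1 K⁻¹ 1) ∧
        (∀ K K' : ℝ, 0 < K → K ≤ K' → arm1 K'⁻¹ 1 ≤ arm1 K⁻¹ 1) ∧
        (∀ K : ℝ, 1 ≤ K → 0 < arm1 K⁻¹ 1 ∧ arm1 K⁻¹ 1 ≤ 1) := by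
  intro hB hC
  -- the support ES from its three landed clauses
  have hW : WiredBoxLimit := WiredBoxLimitProof.stub_wiredBoxLimit
  have hpos : Arm1Pos := Arm1PosProof.stub_arm1Pos hW
  have hES : ArmDressing.InfiniteVolumeEdwardsSokal :=
    infiniteVolumeEdwardsSokal_iff.2 ⟨hW, hpos, EdwardsSokalProof.stub_edwardsSokalIdentity⟩
  -- dressed existence, normalisation, automatic scale covariance with `Δ ∈ [1/2, 1]`
  obtain ⟨S, hlim, hnd⟩ := DressedLimitProof.stub_dressedLimitExists hB hC hES
  have hlim' := MoebiusLimitExistsNegative.normalised_hasLimit hlim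
  have hnd' := MoebiusLimitExistsNegative.normalised_nondeg hnd
  obtain ⟨Δ, hΔ, hsc'⟩ :=
    MoebiusLimitExistsNegative.exists_scaleCovariant_normalised (InvBook.rho1_pos hpos) hlim hnd
  exact ⟨arm1_inv_doubling hpos hlim' hnd' hsc' hΔ.2, arm1_inv_antitone, arm1_inv_pos_le_one hpos⟩

end Summit.CriticalPhenomena.Ising3DConformalLimit.Cruxes.ArmDressingGlue.CrossPos

end
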